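import Summits.RiemannHypothesis.RiemannHypothesis.Theses.GroundBarta
import Summits.RiemannHypothesis.RiemannHypothesis.Theorems.GroundBartaPolarPerronFrobeniusEvenNormalForm
import Summits.RiemannHypothesis.RiemannHypothesis.Theorems.GroundBartaPolarPerronFrobeniusOfEvenConeDense
import Summits.RiemannHypothesis.RiemannHypothesis.Theorems.GroundBartaPolarPerronFrobeniusFormDomainEven
import Summits.RiemannHypothesis.RiemannHypothesis.Theorems.WeilWindowFlowWindowLipschitzStubGroundStateEnergy
import Literature.NumberTheory.LFunctions.WeilSemilocalCompactnessProofs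
import HarnessLib

/-!
# RiemannHypothesis / GroundBarta — crux `PolarPerronFrobenius` (stmt-RiemannHypothesis-18390):
# a one-signed ground state makes the cone DENSE — the registered stub S1 is EXACTLY the crux

Helper file (`--supports stmt-RiemannHypothesis-18390`), RH-free, Mathlib + landed tree files only, no
definitions, no named facts.  The registered skeleton (line `Sketch`) reduces the crux to the single
RH-bearing stub S1 `stub_evenConeDense_cofinal` = `∀ A, ∃ a ≥ A, (EW a → EvenConeDense a)`, where
`EvenConeDense a` says: every even `L²`-normalised window test is matched up to any `δ > 0` by an even,
pointwise real `≥ 0`, normalised window test (`polarPerronFrobenius_of_evenConeDense_cofinal`, p174614,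
via S2–S4).  This file proves the CONVERSE at every window, so that S1 loses nothing:

* `exists_cone_test_le_of_oneSigned` — **SIGN ⇒ CONE DENSITY**: if the window `a` carries a ground state
  of the full form that is real and `≥ 0` a.e. on `(-a, a)`, then for every `δ > 0` there is an EVEN,
  pointwise real `≥ 0`, `L²`-normalised window test `w` with `Re Q(w) ≤ ε(a) + δ`.  Construction: take the
  even real non-negative representative `v` of the ground state (`exists_even_real_nonneg_of_oneSigned`);
  it has finite energy and closed-form energy `P(v) + 𝓔_a(v) − M_a ≤ ε(a)` (`stub_groundStateEnergy`,
  route WeilWindowFlow); DILATE it into the interior (`v_η`, `η → 0⁺`: `𝓔_a(v_η) → 𝓔_a(v)` by dominated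
  convergence in the jump length, `P(v_η) → P(v)`), then MOLLIFY with an even non-negative bump of radius
  below the freed margin (increments contract; `P` and the mass are `L²`-continuous); evenness and
  non-negativity survive both operations, and the Markov decomposition `Re Q = P + 𝓔_a − M_a‖·‖²` bounds
  the energy of the normalised mollified dilate by `ε(a) + δ`.
* `evenConeDense_of_oneSigned`, `coneDense_of_oneSigned` — hence cone density in the even sector and in
  the whole window (`ε(a) ≤ Re Q(h)` on the sphere).
* `exists_oneSigned_of_coneDense`, `oneSigned_iff_coneDense` — conversely (S3 + compactness + S4, as in
  the small-window files): cone density gives a one-signed ground state; `GSP a ↔ ConeDense a`.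
* `polarMatrix_iff_evenConeDenseMatrix`, `polarPerronFrobenius_iff_evenConeDense_cofinal` —
  **at every window `(EW a → GSP a) ↔ (EW a → EvenConeDense a)`, and `PolarPerronFrobenius ↔ S1`
  verbatim**: the RH-bearing stub of the registered skeleton is equivalent to the crux, not merely
  sufficient.

Tools: `Theorems/GroundBartaPolarPerronFrobeniusFormDomainEven.lean` (parity-free continuity of
increments, strong continuity of dilation, energy of dilates, even non-negative mollification).

Prover B, speedrun unit `sr-gb-rung-b` (seat 3).  References: E. Bombieri, Rend. Lincei (9) 11 (2000) §4
Thm 3; M. Fukushima, Y. Oshima, M. Takeda, *Dirichlet Forms and Symmetric Markov Processes* (2011) §1.1,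
Ex. 1.4.1 (cores by mollification); A. Connes, C. Consani, H. Moscovici, arXiv:2511.22755 Thm 3.6.
-/

set_option linter.dupNamespace false

noncomputable section

open MeasureTheory Complex Filter Set
open scoped Real Topology

namespace Summit.RiemannHypothesis.RiemannHypothesis.Theorems.PolarPerronFrobenius

open Literature.NumberTheory.LFunctions
open Summit.RiemannHypothesis.RiemannHypothesis.Theses.GroundBarta
open Summit.RiemannHypothesis.RiemannHypothesis.Theorems.OddSector
  (memLp_weilDilate weilDilate_eq_zero_of_notMem tendsto_weilPoleForm_of_window
    tendsto_integral_norm_sq_of_tendsto_sub)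
open Summit.RiemannHypothesis.RiemannHypothesis.Theorems.WeilWindowFlowWindowLipschitz
  (stub_groundStateEnergy)

/-! ### SIGN ⇒ CONE DENSITY -/

/-- **A one-signed ground state makes the cone dense at the bottom.**  If the window `a` carries a
ground state of the full windowed Weil form that is real and `≥ 0` a.e. on `(-a, a)`, then for every
`δ > 0` there is an EVEN, pointwise real `≥ 0`, `L²`-normalised window test `w` with
`Re Q(w) ≤ ε(a) + δ` (mollified interior dilates of the even non-negative representative; see the module
docstring). [folklore] -/
theorem exists_cone_test_le_of_oneSigned {a : ℝ} {u : ℝ → ℂ} (hu : IsWeilGroundState a u)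
    (hsign : ∀ᵐ t : ℝ, t ∈ Ioo (-a) a → (u t).im = 0 ∧ 0 ≤ (u t).re) {δ : ℝ} (hδ : 0 < δ) :
    ∃ w : ℝ → ℂ, IsWeilTest w ∧ tsupport w ⊆ Icc (-a) a ∧ (∀ t, w (-t) = w t) ∧
      (∀ t, (w t).im = 0 ∧ 0 ≤ (w t).re) ∧ ∫ t, ‖w t‖ ^ 2 = (1 : ℝ) ∧
      (weilQuadratic w).re ≤ weilGroundEnergy a + δ := by
  have ha : 0 < a := hu.pos
  -- (1) the even, real, non-negative representative, truncated to the closed window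
  obtain ⟨v₀, hv₀, hv₀e, hv₀r, hv₀n⟩ := exists_even_real_nonneg_of_oneSigned hu hsign
  set v : ℝ → ℂ := (Icc (-a) a).indicator v₀ with hvdef
  have hv : IsWeilGroundState a v := hv₀.congr_ae hv₀.ae_eq_indicator
  have hvs : ∀ x, x ∉ Icc (-a) a → v x = 0 := fun x hx ↦ indicator_of_notMem hx _
  have hve : ∀ x, v (-x) = v x := fun x ↦ by
    by_cases hx : x ∈ Icc (-a) a
    · have hx' : -x ∈ Icc (-a) a := ⟨by linarith [hx.2], by linarith [hx.1]⟩
      rw [hvdef, indicator_of_mem hx', indicator_of_mem hx, hv₀e]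
    · have hx' : -x ∉ Icc (-a) a := fun h ↦ hx ⟨by linarith [h.2], by linarith [h.1]⟩
      rw [hvdef, indicator_of_notMem hx', indicator_of_notMem hx]
  have hvr : ∀ x, (v x).im = 0 ∧ 0 ≤ (v x).re := fun x ↦ by
    by_cases hx : x ∈ Icc (-a) a
    · rw [hvdef, indicator_of_mem hx]; exact ⟨hv₀r x, hv₀n x⟩
    · rw [hvdef, indicator_of_notMem hx]; simp
  have hvm : MemLp v 2 := hv.memLp
  have hvN : ∫ x, ‖v x‖ ^ 2 = 1 := hv.integral_norm_sq
  -- (2) finite energy and the closed-form bound `P(v) + 𝓔_a(v) ≤ M_a + ε(a)`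
  obtain ⟨hvE, hC2⟩ := stub_groundStateEnergy a v hv
  rw [hvN, mul_one] at hC2
  -- (3) interior dilates
  set η : ℕ → ℝ := fun n ↦ 1 / ((n : ℝ) + 1) with hηdef
  have hη0 : ∀ n, 0 ≤ η n := fun n ↦ by positivity
  have hηpos : ∀ n, 0 < η n := fun n ↦ by positivity
  have hη1 : ∀ n, η n ≤ 1 := fun n ↦ by
    rw [hηdef, div_le_one (by positivity)]; linarith [n.cast_nonneg (α := ℝ)]
  have hηm1 : ∀ n, -1 < η n := fun n ↦ by linarith [hη0 n]
  have hηlim : Tendsto η atTop (𝓝 0) := tendsto_one_div_add_atTop_nhds_zero_nat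
  set f : ℕ → ℝ → ℂ := fun n ↦ weilDilate (η n) v with hfdef
  have hfm : ∀ n, MemLp (f n) 2 := fun n ↦ memLp_weilDilate hvm (hηm1 n)
  have hfs : ∀ n x, x ∉ Icc (-(a / (1 + η n))) (a / (1 + η n)) → f n x = 0 := fun n x hx ↦
    weilDilate_eq_zero_of_notMem (hηm1 n) hvs hx
  have hba : ∀ n, a / (1 + η n) < a := fun n ↦ by
    rw [div_lt_iff₀ (by linarith [hη0 n])]; nlinarith [hηpos n]
  have hfs' : ∀ n x, x ∉ Icc (-a) a → f n x = 0 := fun n x hx ↦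
    hfs n x fun h ↦ hx ⟨by linarith [h.1, (hba n).le, neg_le_neg (hba n).le], h.2.trans (hba n).le⟩
  have hfe : ∀ n x, f n (-x) = f n x := fun n x ↦ by
    have := stub_sectorContinuity_weilDilate_parity (g := v) (σ := 1)
      (fun t ↦ by rw [one_mul]; exact hve t) (η n) x
    simpa using this
  have hfr : ∀ n x, (f n x).im = 0 ∧ 0 ≤ (f n x).re := fun n x ↦ by
    simp only [hfdef, weilDilate_apply, Complex.mul_im, Complex.mul_re, Complex.ofReal_re,
      Complex.ofReal_im, (hvr _).1, mul_zero, zero_mul, add_zero, sub_zero]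
    exact ⟨trivial, mul_nonneg (Real.sqrt_nonneg _) (hvr _).2⟩
  have hfN : ∀ n, ∫ x, ‖f n x‖ ^ 2 = 1 := fun n ↦ by
    rw [hfdef, integral_norm_sq_weilDilate v (hηm1 n), hvN]
  obtain ⟨hfE, hElim⟩ := tendsto_weilDirichletEnergy_weilDilate_window a ha hvm hvs hvE hη0 hη1 hηlim
  have hfL : Tendsto (fun n ↦ ∫ x, ‖f n x - v x‖ ^ 2) atTop (𝓝 0) :=
    tendsto_integral_norm_sq_weilDilate_sub_window hvm hvs hη0 hη1 hηlim
  have hPlim : Tendsto (fun n ↦ weilPoleForm (f n)) atTop (𝓝 (weilPoleForm v)) :=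
    tendsto_weilPoleForm_of_window hvm hfm hvs hfs' hfL
  -- (4) fix a dilate with energy and pole form within `δ/4`
  have hev1 : ∀ᶠ n in atTop, weilDirichletEnergy a (f n) < weilDirichletEnergy a v + δ / 4 :=
    hElim.eventually (eventually_lt_nhds (by linarith))
  have hev2 : ∀ᶠ n in atTop, weilPoleForm (f n) < weilPoleForm v + δ / 4 :=
    hPlim.eventually (eventually_lt_nhds (by linarith))
  obtain ⟨n, hn1, hn2⟩ := (hev1.and hev2).exists
  -- (5) mollify the chosen dilate inside the freed margin
  set b : ℝ := a / (1 + η n) with hbdef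
  have hb0 : 0 < b := div_pos ha (by linarith [hη0 n])
  have hmargin : 0 < a - b := by linarith [hba n]
  obtain ⟨g, hgt, hge, hgr, hgs, hgD, hgL⟩ :=
    exists_even_nonneg_mollified_seq (hfm n) (hfs n) (hfe n) (hfr n)
  have hgm : ∀ k, MemLp (g k) 2 := fun k ↦ (hgt k).memLp_two
  -- supports: eventually inside `[-a, a]`; always inside `[-(a+1), a+1]`
  have hgs1 : ∀ k x, x ∉ Icc (-(a + 1)) (a + 1) → g k x = 0 := fun k x hx ↦
    image_eq_zero_of_notMem_tsupport fun h ↦ hx (by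
      have h' := hgs k h
      have hk1 : 1 / ((k : ℝ) + 1) ≤ 1 := by
        rw [div_le_one (by positivity)]; linarith [k.cast_nonneg (α := ℝ)]
      exact ⟨by linarith [h'.1, (hba n).le], by linarith [h'.2, (hba n).le]⟩)
  have hfs1 : ∀ x, x ∉ Icc (-(a + 1)) (a + 1) → f n x = 0 := fun x hx ↦
    hfs' n x fun h ↦ hx ⟨by linarith [h.1], by linarith [h.2]⟩
  have hevS : ∀ᶠ k in atTop, tsupport (g k) ⊆ Icc (-a) a := by
    have : ∀ᶠ k : ℕ in atTop, 1 / ((k : ℝ) + 1) < a - b :=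
      tendsto_one_div_add_atTop_nhds_zero_nat.eventually (eventually_lt_nhds hmargin)
    filter_upwards [this] with k hk
    exact (hgs k).trans (Icc_subset_Icc (by linarith) (by linarith))
  -- masses and pole forms converge along the mollifications
  have hNlim : Tendsto (fun k ↦ ∫ x, ‖g k x‖ ^ 2) atTop (𝓝 1) := by
    have := tendsto_integral_norm_sq_of_tendsto_sub hgm (hfm n) hgL
    rwa [hfN n] at this
  have hPg : Tendsto (fun k ↦ weilPoleForm (g k)) atTop (𝓝 (weilPoleForm (f n))) :=
    tendsto_weilPoleForm_of_window (hfm n) hgm hfs1 hgs1 hgL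
  -- the Rayleigh bound `R_k = (P(g_k) + 𝓔_a(f_n) − M_a N_k)/N_k → P(f_n) + 𝓔_a(f_n) − M_a`
  set R : ℕ → ℝ := fun k ↦ (weilPoleForm (g k) + weilDirichletEnergy a (f n) -
    weilMarkovConstant a * ∫ x, ‖g k x‖ ^ 2) / ∫ x, ‖g k x‖ ^ 2 with hRdef
  have hRlim : Tendsto R atTop (𝓝 ((weilPoleForm (f n) + weilDirichletEnergy a (f n) -
      weilMarkovConstant a * 1) / 1)) :=
    ((hPg.add tendsto_const_nhds).sub (hNlim.const_mul _)).div hNlim one_ne_zero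
  rw [mul_one, div_one] at hRlim
  have htarget : weilPoleForm (f n) + weilDirichletEnergy a (f n) - weilMarkovConstant a <
      weilGroundEnergy a + δ := by linarith
  have hevR : ∀ᶠ k in atTop, R k < weilGroundEnergy a + δ := hRlim.eventually (eventually_lt_nhds htarget)
  have hevN : ∀ᶠ k in atTop, (1 / 2 : ℝ) < ∫ x, ‖g k x‖ ^ 2 :=
    hNlim.eventually (eventually_gt_nhds (by norm_num))
  obtain ⟨k, hkS, hkR, hkN⟩ := (hevS.and (hevR.and hevN)).exists
  -- (6) normalise the chosen mollified dilate
  set N : ℝ := ∫ x, ‖g k x‖ ^ 2 with hNdef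
  have hNpos : 0 < N := by linarith
  set c : ℝ := (Real.sqrt N)⁻¹ with hcdef
  have hcpos : 0 < c := inv_pos.2 (Real.sqrt_pos.2 hNpos)
  have hcsq : c * c = N⁻¹ := by
    rw [hcdef, ← mul_inv, Real.mul_self_sqrt hNpos.le]
  refine ⟨fun t ↦ (c : ℂ) * g k t, (hgt k).const_mul c, tsupport_mul_subset_right.trans hkS,
    fun t ↦ by simp only [hge k t], fun t ↦ ?_, ?_, ?_⟩
  · simp only [Complex.mul_im, Complex.mul_re, Complex.ofReal_re, Complex.ofReal_im, (hgr k t).1,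
      mul_zero, zero_mul, add_zero, sub_zero]
    exact ⟨trivial, mul_nonneg hcpos.le (hgr k t).2⟩
  · simp only [norm_mul, mul_pow, Complex.norm_real, Real.norm_of_nonneg hcpos.le]
    rw [integral_const_mul, ← hNdef, show c ^ 2 = c * c by ring, hcsq, inv_mul_cancel₀ hNpos.ne']
  · -- `Re Q(c g_k) = Re Q(g_k)/N ≤ R_k < ε(a) + δ`
    have hQ : (weilQuadratic fun t ↦ (c : ℂ) * g k t).re = c * c * (weilQuadratic (g k)).re := by
      rw [weilQuadratic_const_mul, Complex.normSq_ofReal, Complex.re_ofReal_mul]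
    have hMarkov := weilQuadratic_re_eq_weilPoleForm_add_weilDirichletEnergy_sub (hgt k) hkS
    have hEg : weilDirichletEnergy a (g k) ≤ weilDirichletEnergy a (f n) :=
      weilDirichletEnergy_le_of_increment_le (hgD k)
        (integrableOn_weilArchDensity_mul_weilIncrement (hgt k)) (hfE n)
    have hQg : (weilQuadratic (g k)).re ≤
        weilPoleForm (g k) + weilDirichletEnergy a (f n) - weilMarkovConstant a * N := by
      rw [hMarkov]; linarith
    have hRk : R k = (weilPoleForm (g k) + weilDirichletEnergy a (f n) -
        weilMarkovConstant a * N) / N := rfl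
    rw [hQ, hcsq]
    calc N⁻¹ * (weilQuadratic (g k)).re
        ≤ N⁻¹ * (weilPoleForm (g k) + weilDirichletEnergy a (f n) - weilMarkovConstant a * N) :=
          mul_le_mul_of_nonneg_left hQg (inv_nonneg.2 hNpos.le)
      _ = R k := by rw [hRk, div_eq_inv_mul]
      _ ≤ weilGroundEnergy a + δ := hkR.le

/-- **SIGN ⇒ EVEN CONE DENSITY**: at a window carrying a one-signed ground state of the full form,
every even `L²`-normalised window test `h` is matched up to any `δ > 0` by an even, pointwise real `≥ 0`,
normalised window test (`ε(a) ≤ Re Q(h)` on the sphere) — the conclusion of the registered stub S1's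
matrix. [folklore] -/
theorem evenConeDense_of_oneSigned {a : ℝ} {u : ℝ → ℂ} (hu : IsWeilGroundState a u)
    (hsign : ∀ᵐ t : ℝ, t ∈ Ioo (-a) a → (u t).im = 0 ∧ 0 ≤ (u t).re) :
    ∀ h : ℝ → ℂ, IsWeilTest h → tsupport h ⊆ Icc (-a) a → (∀ t, h (-t) = h t) →
      ∫ t, ‖h t‖ ^ 2 = (1 : ℝ) → ∀ δ : ℝ, 0 < δ →
        ∃ w : ℝ → ℂ, IsWeilTest w ∧ tsupport w ⊆ Icc (-a) a ∧ (∀ t, w (-t) = w t) ∧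
          (∀ t, (w t).im = 0 ∧ 0 ≤ (w t).re) ∧ ∫ t, ‖w t‖ ^ 2 = (1 : ℝ) ∧
          (weilQuadratic w).re ≤ (weilQuadratic h).re + δ := by
  intro h hh hhs _ hhn δ hδ
  obtain ⟨w, hw, hws, hwe, hwr, hwn, hwQ⟩ := exists_cone_test_le_of_oneSigned hu hsign hδ
  exact ⟨w, hw, hws, hwe, hwr, hwn, hwQ.trans (by linarith [weilGroundEnergy_le_of_sphere hh hhs hhn])⟩

/-- **SIGN ⇒ CONE DENSITY (parity-free)**: at a window carrying a one-signed ground state, every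
`L²`-normalised window test is matched up to any `δ > 0` by a pointwise real `≥ 0` normalised window
test. [folklore] -/
theorem coneDense_of_oneSigned {a : ℝ} {u : ℝ → ℂ} (hu : IsWeilGroundState a u)
    (hsign : ∀ᵐ t : ℝ, t ∈ Ioo (-a) a → (u t).im = 0 ∧ 0 ≤ (u t).re) :
    ∀ h : ℝ → ℂ, IsWeilTest h → tsupport h ⊆ Icc (-a) a → ∫ t, ‖h t‖ ^ 2 = (1 : ℝ) →
      ∀ δ : ℝ, 0 < δ → ∃ w : ℝ → ℂ, IsWeilTest w ∧ tsupport w ⊆ Icc (-a) a ∧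
        (∀ t, (w t).im = 0 ∧ 0 ≤ (w t).re) ∧ ∫ t, ‖w t‖ ^ 2 = (1 : ℝ) ∧
        (weilQuadratic w).re ≤ (weilQuadratic h).re + δ := by
  intro h hh hhs hhn δ hδ
  obtain ⟨w, hw, hws, -, hwr, hwn, hwQ⟩ := exists_cone_test_le_of_oneSigned hu hsign hδ
  exact ⟨w, hw, hws, hwr, hwn, hwQ.trans (by linarith [weilGroundEnergy_le_of_sphere hh hhs hhn])⟩

/-! ### CONE DENSITY ⇒ SIGN (S3 + compactness + S4), and the equivalences -/

/-- **Cone density gives a one-signed ground state** (cone minimising sequence S3, compactness of the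
form embedding, sign in the limit S4 — the argument of the small-window files at an arbitrary window).
[folklore] -/
theorem exists_oneSigned_of_coneDense {a : ℝ} (ha : 0 < a)
    (hcone : ∀ h : ℝ → ℂ, IsWeilTest h → tsupport h ⊆ Icc (-a) a → ∫ t, ‖h t‖ ^ 2 = (1 : ℝ) →
      ∀ δ : ℝ, 0 < δ → ∃ w : ℝ → ℂ, IsWeilTest w ∧ tsupport w ⊆ Icc (-a) a ∧
        (∀ t, (w t).im = 0 ∧ 0 ≤ (w t).re) ∧ ∫ t, ‖w t‖ ^ 2 = (1 : ℝ) ∧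
        (weilQuadratic w).re ≤ (weilQuadratic h).re + δ) :
    ∃ u : ℝ → ℂ, IsWeilGroundState a u ∧ ∀ᵐ t : ℝ, t ∈ Ioo (-a) a → (u t).im = 0 ∧ 0 ≤ (u t).re := by
  obtain ⟨g, hg, hQ⟩ := stub_coneMinimizingSeq a ha hcone
  have hg' : ∀ n, IsWeilTest (g n) ∧ tsupport (g n) ⊆ Icc (-a) a ∧ ∫ t, ‖g n t‖ ^ 2 = (1 : ℝ) :=
    fun n ↦ ⟨(hg n).1, (hg n).2.1, (hg n).2.2.2⟩
  obtain ⟨u, hu, φ, hφ, hconv⟩ :=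
    ConnesConsaniMoscovici2025_thm_3_6_holds a ha g hg' hQ.bddAbove_range
  have hQ' : Tendsto (fun n ↦ (weilQuadratic (g (φ n))).re) atTop (𝓝 (weilGroundEnergy a)) :=
    hQ.comp hφ.tendsto_atTop
  have hmem : ∀ n, MemLp (g (φ n)) 2 := fun n ↦ (hg' (φ n)).1.memLp_two
  have hsign := stub_aeNonneg_of_L2_limit (fun n ↦ g (φ n)) u hmem hu
    (fun n t ↦ (hg (φ n)).2.2.1 t) hconv
  exact ⟨u, ⟨hu, fun n ↦ g (φ n), fun n ↦ hg' (φ n), hQ', hconv⟩, hsign.mono fun t ht _ ↦ ht⟩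

/-- **At every window `a > 0`: `GSP a ↔ ConeDense a`** (one-signed ground state ⟺ non-negative tests
are energy-dense on the sphere). [folklore] -/
theorem oneSigned_iff_coneDense {a : ℝ} (ha : 0 < a) :
    (∃ u : ℝ → ℂ, IsWeilGroundState a u ∧ ∀ᵐ t : ℝ, t ∈ Ioo (-a) a → (u t).im = 0 ∧ 0 ≤ (u t).re) ↔
      ∀ h : ℝ → ℂ, IsWeilTest h → tsupport h ⊆ Icc (-a) a → ∫ t, ‖h t‖ ^ 2 = (1 : ℝ) →
        ∀ δ : ℝ, 0 < δ → ∃ w : ℝ → ℂ, IsWeilTest w ∧ tsupport w ⊆ Icc (-a) a ∧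
          (∀ t, (w t).im = 0 ∧ 0 ≤ (w t).re) ∧ ∫ t, ‖w t‖ ^ 2 = (1 : ℝ) ∧
          (weilQuadratic w).re ≤ (weilQuadratic h).re + δ :=
  ⟨fun ⟨_, hu, hsign⟩ ↦ coneDense_of_oneSigned hu hsign, exists_oneSigned_of_coneDense ha⟩

/-- **The crux's matrix and S1's matrix agree at every window `a > 0`**:
`(EW a → GSP a) ↔ (EW a → EvenConeDense a)` (`←` through S2 `stub_coneDense_of_even`, S3, compactness,
S4; `→` by SIGN ⇒ EVEN CONE DENSITY). [folklore] -/
theorem polarMatrix_iff_evenConeDenseMatrix {a : ℝ} (ha : 0 < a) :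
    ((∀ o : ℝ → ℂ, IsWeilTest o → tsupport o ⊆ Icc (-a) a → (∀ t, o (-t) = -o t) →
        ∫ t, ‖o t‖ ^ 2 = (1 : ℝ) → ∀ δ : ℝ, 0 < δ → ∃ w : ℝ → ℂ, IsWeilTest w ∧
          tsupport w ⊆ Icc (-a) a ∧ (∀ t, w (-t) = w t) ∧ ∫ t, ‖w t‖ ^ 2 = (1 : ℝ) ∧
          (weilQuadratic w).re ≤ (weilQuadratic o).re + δ) →
      ∃ u : ℝ → ℂ, IsWeilGroundState a u ∧
        ∀ᵐ t : ℝ, t ∈ Ioo (-a) a → (u t).im = 0 ∧ 0 ≤ (u t).re) ↔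
    ((∀ o : ℝ → ℂ, IsWeilTest o → tsupport o ⊆ Icc (-a) a → (∀ t, o (-t) = -o t) →
        ∫ t, ‖o t‖ ^ 2 = (1 : ℝ) → ∀ δ : ℝ, 0 < δ → ∃ w : ℝ → ℂ, IsWeilTest w ∧
          tsupport w ⊆ Icc (-a) a ∧ (∀ t, w (-t) = w t) ∧ ∫ t, ‖w t‖ ^ 2 = (1 : ℝ) ∧
          (weilQuadratic w).re ≤ (weilQuadratic o).re + δ) →
      ∀ h : ℝ → ℂ, IsWeilTest h → tsupport h ⊆ Icc (-a) a → (∀ t, h (-t) = h t) →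
        ∫ t, ‖h t‖ ^ 2 = (1 : ℝ) → ∀ δ : ℝ, 0 < δ →
          ∃ w : ℝ → ℂ, IsWeilTest w ∧ tsupport w ⊆ Icc (-a) a ∧ (∀ t, w (-t) = w t) ∧
            (∀ t, (w t).im = 0 ∧ 0 ≤ (w t).re) ∧ ∫ t, ‖w t‖ ^ 2 = (1 : ℝ) ∧
            (weilQuadratic w).re ≤ (weilQuadratic h).re + δ) := by
  refine ⟨fun h hEW ↦ ?_, fun h hEW ↦ ?_⟩
  · obtain ⟨u, hu, hsign⟩ := h hEW
    exact evenConeDense_of_oneSigned hu hsign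
  · exact exists_oneSigned_of_coneDense ha (stub_coneDense_of_even a ha hEW (h hEW))

/-- **`PolarPerronFrobenius ↔ S1` (`stub_evenConeDense_cofinal`, verbatim)**: the single RH-bearing
stub of the registered skeleton is EQUIVALENT to the crux (`←` is the landed reduction
`polarPerronFrobenius_of_evenConeDense_cofinal`; `→` is SIGN ⇒ EVEN CONE DENSITY at the witness
windows). [folklore] -/
theorem polarPerronFrobenius_iff_evenConeDense_cofinal :
    PolarPerronFrobenius ↔
      ∀ A : ℝ, ∃ a : ℝ, A ≤ a ∧
        ((∀ o : ℝ → ℂ, IsWeilTest o → tsupport o ⊆ Set.Icc (-a) a →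
              (∀ t, o (-t) = -o t) → ∫ t, ‖o t‖ ^ 2 = (1 : ℝ) → ∀ δ : ℝ, 0 < δ →
                ∃ w : ℝ → ℂ, IsWeilTest w ∧ tsupport w ⊆ Set.Icc (-a) a ∧ (∀ t, w (-t) = w t) ∧
                  ∫ t, ‖w t‖ ^ 2 = (1 : ℝ) ∧ (weilQuadratic w).re ≤ (weilQuadratic o).re + δ) →
          ∀ h : ℝ → ℂ, IsWeilTest h → tsupport h ⊆ Set.Icc (-a) a → (∀ t, h (-t) = h t) →
              ∫ t, ‖h t‖ ^ 2 = (1 : ℝ) → ∀ δ : ℝ, 0 < δ →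
                ∃ w : ℝ → ℂ, IsWeilTest w ∧ tsupport w ⊆ Set.Icc (-a) a ∧ (∀ t, w (-t) = w t) ∧
                  (∀ t, (w t).im = 0 ∧ 0 ≤ (w t).re) ∧ ∫ t, ‖w t‖ ^ 2 = (1 : ℝ) ∧
                  (weilQuadratic w).re ≤ (weilQuadratic h).re + δ) := by
  refine ⟨fun hPF A ↦ ?_, polarPerronFrobenius_of_evenConeDense_cofinal⟩
  obtain ⟨a, ha, hmat⟩ := polarPerronFrobenius_iff_groundEnergy.1 hPF (max A 1)
  have ha0 : 0 < a := lt_of_lt_of_le one_pos ((le_max_right A 1).trans ha)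
  refine ⟨a, (le_max_left A 1).trans ha, fun hEW ↦ ?_⟩
  obtain ⟨u, hu, hsign⟩ := hmat (weilEvenGroundEnergy_le_weilOddGroundEnergy_of_evenWinsAt ha0 hEW)
  exact evenConeDense_of_oneSigned hu hsign

end Summit.RiemannHypothesis.RiemannHypothesis.Theorems.PolarPerronFrobenius

end
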